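import Summits.AtomisticToContinuum.HydrodynamicLimit.Theorems.CollisionIsometryCLTAdaptedWeightCLTCBPointwise

/-!
# Stub `stub_freeStretch` of the line `Sketch` (contact-balance composition) for the crux
`AdaptedWeightCLT` (stmt-AtomisticToContinuum-14868; `--supports`)

LIPSCHITZ ⇒ FREE-STRETCH BOUND (`FreeFlightLipschitz γ φ σ → FreeStretchBound γ φ σ`): the increment of
the block anisotropy `anis = ∫ₓ Σ D² + |q|²` over ONE free stretch of an orbit (no collisions: pure real
analysis in the time variable).
* REVERSE TRIANGLE in `L²ₓ`: `|anis(w₂) − anis(w₁)| ≤ 12 · l2dist(w₁, w₂) · (√anis(w₁) + √anis(w₂))`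
  (componentwise `|b² − a²| ≤ |b − a| (|a| + |b|)`, then Cauchy–Schwarz in `x`; the twelve components
  of `(D, q)` are bounded and measurable in `x` — NOT continuous where the block empties — hence square
  integrable on `𝕋³`);
* free flight is additive in time and keeps the velocities, so the hypothesis gives
  `l2dist(w_r, w_{r'}) ≤ K (N+1)^γ (1 + v_max)⁴ (r' − r)` along the stretch, and `g(r) = √anis(w_r)` is
  Lipschitz on `[0, T]` with constant `12 K (N+1)^γ (1 + v_max)⁴`;
* CALCULUS: `g ≥ 0` Lipschitz with constant `ℓ` on `[0, T]` ⇒ `g(T)² − g(0)² = ∫₀ᵀ 2 g g' ≤ 2ℓ ∫₀ᵀ g`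
  (absolute continuity, `AbsolutelyContinuousOnInterval.integral_deriv_mul_eq_sub`, `|g'| ≤ ℓ` on
  `(0, T)` by `norm_deriv_le_of_lipschitzOn`).
The constant of `FreeStretchBound` is `24 · max K 0`, its `N₀` that of the hypothesis.
-/

namespace Summit.AtomisticToContinuum.HydrodynamicLimit.Theorems.ContactBalance

open scoped BigOperators Topology Classical MeasureTheory ENNReal InnerProductSpace
open Filter Set MeasureTheory
open Literature.Analysis.FluidPDE
open Summit.AtomisticToContinuum.HydrodynamicLimit.Theorems.ContactSourceDuhamel
open Summit.AtomisticToContinuum.HydrodynamicLimit.Theorems.ContactSourceDuhamel.TimeLocal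
open Literature.MathematicalPhysics.KineticTheory (hsDiameter)

noncomputable section

namespace FreeStretch

/-! ## Calculus: a nonnegative Lipschitz `g` has `g(T)² − g(0)² ≤ 2ℓ ∫₀ᵀ g` -/

/-- CORE CALCULUS. If `g ≥ 0` is `ℓ`-Lipschitz on `[0, T]`, then `g(T)² − g(0)² ≤ 2ℓ ∫₀ᵀ g`
(`g` is absolutely continuous, `∫₀ᵀ (g' g + g g') = g(T)² − g(0)²`, and `|g'| ≤ ℓ` on `(0, T)`). -/
theorem sq_sub_sq_le_integral {g : ℝ → ℝ} {ℓ T : ℝ} (hT : 0 ≤ T) (hℓ : 0 ≤ ℓ)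
    (hg : ∀ r ∈ Icc 0 T, 0 ≤ g r) (hlip : LipschitzOnWith ℓ.toNNReal g (Icc 0 T)) :
    g T ^ 2 - g 0 ^ 2 ≤ 2 * ℓ * ∫ r in Icc 0 T, g r := by
  have hlip' : LipschitzOnWith ℓ.toNNReal g (uIcc 0 T) := by rwa [uIcc_of_le hT]
  have hAC : AbsolutelyContinuousOnInterval g 0 T := hlip'.absolutelyContinuousOnInterval
  have hcont : ContinuousOn g (uIcc 0 T) := hAC.continuousOn
  have hFTC := hAC.integral_deriv_mul_eq_sub hAC
  have hd : IntervalIntegrable (deriv g) volume 0 T := hAC.intervalIntegrable_deriv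
  have hmono : ∫ x in 0..T, (deriv g x * g x + g x * deriv g x) ≤ ∫ x in 0..T, 2 * ℓ * g x := by
    refine intervalIntegral.integral_mono_on_of_le_Ioo hT
      ((hd.mul_continuousOn hcont).add (hd.continuousOn_mul hcont)) (hcont.intervalIntegrable.const_mul _)
      fun x hx => ?_
    have h1 : deriv g x ≤ ℓ := by
      have h := norm_deriv_le_of_lipschitzOn (Icc_mem_nhds hx.1 hx.2) hlip
      rw [Real.norm_eq_abs, Real.coe_toNNReal _ hℓ] at h
      exact (le_abs_self _).trans h
    have h0 : 0 ≤ g x := hg x (Ioo_subset_Icc_self hx)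
    nlinarith
  rw [hFTC, intervalIntegral.integral_const_mul, intervalIntegral.integral_of_le hT,
    ← integral_Icc_eq_integral_Ioc] at hmono
  nlinarith [hmono]

/-- `|y² − x²| ≤ d (x + y)` with `x, y, d ≥ 0` forces `|y − x| ≤ d`. -/
theorem abs_sub_le_of_abs_sq_sub_sq_le {x y d : ℝ} (hx : 0 ≤ x) (hy : 0 ≤ y) (hd : 0 ≤ d)
    (h : |y ^ 2 - x ^ 2| ≤ d * (x + y)) : |y - x| ≤ d := by
  rcases (add_nonneg hx hy).eq_or_lt with h0 | hpos
  · have hx0 : x = 0 := by linarith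
    have hy0 : y = 0 := by linarith
    rw [hx0, hy0, sub_zero, abs_zero]
    exact hd
  · rw [sq_sub_sq, abs_mul, abs_of_pos (by linarith : 0 < y + x), add_comm y x] at h
    exact le_of_mul_le_mul_left (h.trans_eq (mul_comm _ _)) hpos

/-! ## Cauchy–Schwarz -/

/-- CAUCHY–SCHWARZ for nonnegative square-integrable real functions: `∫ f g ≤ √(∫ f²) √(∫ g²)`. -/
theorem integral_mul_le_sqrt_mul_sqrt {α : Type*} [MeasurableSpace α] {μ : Measure α} {f g : α → ℝ}
    (hf0 : ∀ x, 0 ≤ f x) (hg0 : ∀ x, 0 ≤ g x) (hf : MemLp f 2 μ) (hg : MemLp g 2 μ) :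
    ∫ x, f x * g x ∂μ ≤ Real.sqrt (∫ x, f x ^ 2 ∂μ) * Real.sqrt (∫ x, g x ^ 2 ∂μ) := by
  have h := integral_mul_le_Lp_mul_Lq_of_nonneg Real.HolderConjugate.two_two (Eventually.of_forall hf0)
    (Eventually.of_forall hg0) (by simpa using hf) (by simpa using hg)
  simp only [Real.rpow_two, one_div, Real.sqrt_eq_rpow] at h ⊢
  exact h

/-- One component of the reverse triangle inequality: `|b² − a²| ≤ √E (√A + √B)` when `a² ≤ A`,
`b² ≤ B`, `(b − a)² ≤ E`. -/
theorem abs_sq_sub_sq_le {a b A B E : ℝ} (ha : a ^ 2 ≤ A) (hb : b ^ 2 ≤ B) (he : (b - a) ^ 2 ≤ E) :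
    |b ^ 2 - a ^ 2| ≤ Real.sqrt E * (Real.sqrt A + Real.sqrt B) := by
  have h1 : |b - a| ≤ Real.sqrt E := Real.abs_le_sqrt he
  have h2 : |a| ≤ Real.sqrt A := Real.abs_le_sqrt ha
  have h3 : |b| ≤ Real.sqrt B := Real.abs_le_sqrt hb
  rw [sq_sub_sq, abs_mul]
  calc |b + a| * |b - a| ≤ (|b| + |a|) * |b - a| :=
        mul_le_mul_of_nonneg_right (abs_add_le _ _) (abs_nonneg _)
    _ ≤ (Real.sqrt B + Real.sqrt A) * Real.sqrt E :=
        mul_le_mul (add_le_add h3 h2) h1 (abs_nonneg _) (by positivity)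
    _ = Real.sqrt E * (Real.sqrt A + Real.sqrt B) := by ring

/-- A single stress entry is dominated by `Σ D² + |q|²`. -/
theorem sq_le_defect (D : Fin 3 → Fin 3 → ℝ) (q : Fin 3 → ℝ) (j k : Fin 3) :
    D j k ^ 2 ≤ (∑ j, ∑ k, D j k ^ 2) + ∑ a, q a ^ 2 := by
  have h1 : D j k ^ 2 ≤ ∑ k', D j k' ^ 2 :=
    Finset.single_le_sum (f := fun k' => D j k' ^ 2) (fun _ _ => sq_nonneg _) (Finset.mem_univ k)
  have h2 : ∑ k', D j k' ^ 2 ≤ ∑ j', ∑ k', D j' k' ^ 2 :=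
    Finset.single_le_sum (f := fun j' => ∑ k', D j' k' ^ 2)
      (fun _ _ => Finset.sum_nonneg fun _ _ => sq_nonneg _) (Finset.mem_univ j)
  exact (h1.trans h2).trans (le_add_of_nonneg_right (Finset.sum_nonneg fun _ _ => sq_nonneg _))

/-- A single heat-flux entry is dominated by `Σ D² + |q|²`. -/
theorem sq_le_defect' (D : Fin 3 → Fin 3 → ℝ) (q : Fin 3 → ℝ) (a : Fin 3) :
    q a ^ 2 ≤ (∑ j, ∑ k, D j k ^ 2) + ∑ a, q a ^ 2 := by
  have h1 : q a ^ 2 ≤ ∑ a', q a' ^ 2 :=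
    Finset.single_le_sum (f := fun a' => q a' ^ 2) (fun _ _ => sq_nonneg _) (Finset.mem_univ a)
  exact h1.trans (le_add_of_nonneg_left
    (Finset.sum_nonneg fun _ _ => Finset.sum_nonneg fun _ _ => sq_nonneg _))

/-- FINITE-DIMENSIONAL REVERSE TRIANGLE: `|(Σ D₂² + |q₂|²) − (Σ D₁² + |q₁|²)| ≤ 12 √E (√A + √B)` with
`E = Σ (D₂ − D₁)² + |q₂ − q₁|²`, `A`, `B` the two defects (twelve components, each bounded by
`abs_sq_sub_sq_le`). -/
theorem abs_defect_sub_defect_le (D₁ D₂ : Fin 3 → Fin 3 → ℝ) (q₁ q₂ : Fin 3 → ℝ) :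
    |((∑ j, ∑ k, D₂ j k ^ 2) + ∑ a, q₂ a ^ 2) - ((∑ j, ∑ k, D₁ j k ^ 2) + ∑ a, q₁ a ^ 2)| ≤
      12 * (Real.sqrt ((∑ j, ∑ k, (D₂ j k - D₁ j k) ^ 2) + ∑ a, (q₂ a - q₁ a) ^ 2) *
        (Real.sqrt ((∑ j, ∑ k, D₁ j k ^ 2) + ∑ a, q₁ a ^ 2) +
          Real.sqrt ((∑ j, ∑ k, D₂ j k ^ 2) + ∑ a, q₂ a ^ 2))) := by
  set c : ℝ := Real.sqrt ((∑ j, ∑ k, (D₂ j k - D₁ j k) ^ 2) + ∑ a, (q₂ a - q₁ a) ^ 2) *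
    (Real.sqrt ((∑ j, ∑ k, D₁ j k ^ 2) + ∑ a, q₁ a ^ 2) +
      Real.sqrt ((∑ j, ∑ k, D₂ j k ^ 2) + ∑ a, q₂ a ^ 2)) with hc
  have hD : ∀ j k, |D₂ j k ^ 2 - D₁ j k ^ 2| ≤ c := fun j k =>
    abs_sq_sub_sq_le (sq_le_defect D₁ q₁ j k) (sq_le_defect D₂ q₂ j k)
      (sq_le_defect (fun j k => D₂ j k - D₁ j k) (fun a => q₂ a - q₁ a) j k)
  have hq : ∀ a, |q₂ a ^ 2 - q₁ a ^ 2| ≤ c := fun a =>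
    abs_sq_sub_sq_le (sq_le_defect' D₁ q₁ a) (sq_le_defect' D₂ q₂ a)
      (sq_le_defect' (fun j k => D₂ j k - D₁ j k) (fun a => q₂ a - q₁ a) a)
  have e : ((∑ j, ∑ k, D₂ j k ^ 2) + ∑ a, q₂ a ^ 2) - ((∑ j, ∑ k, D₁ j k ^ 2) + ∑ a, q₁ a ^ 2) =
      (∑ j, ∑ k, (D₂ j k ^ 2 - D₁ j k ^ 2)) + ∑ a, (q₂ a ^ 2 - q₁ a ^ 2) := by
    simp only [Finset.sum_sub_distrib]
    ring
  rw [e]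
  have hS1 : |∑ j, ∑ k, (D₂ j k ^ 2 - D₁ j k ^ 2)| ≤ ∑ _j : Fin 3, ∑ _k : Fin 3, c :=
    (Finset.abs_sum_le_sum_abs _ _).trans (Finset.sum_le_sum fun j _ =>
      (Finset.abs_sum_le_sum_abs _ _).trans (Finset.sum_le_sum fun k _ => hD j k))
  have hS2 : |∑ a, (q₂ a ^ 2 - q₁ a ^ 2)| ≤ ∑ _a : Fin 3, c :=
    (Finset.abs_sum_le_sum_abs _ _).trans (Finset.sum_le_sum fun a _ => hq a)
  simp only [Finset.sum_const, Finset.card_univ, Fintype.card_fin, nsmul_eq_mul, Nat.cast_ofNat] at hS1 hS2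
  calc _ ≤ |∑ j, ∑ k, (D₂ j k ^ 2 - D₁ j k ^ 2)| + |∑ a, (q₂ a ^ 2 - q₁ a ^ 2)| := abs_add_le _ _
    _ ≤ 3 * (3 * c) + 3 * c := add_le_add hS1 hS2
    _ = 12 * c := by ring

/-! ## The block fields of a configuration: measurable and bounded in `x` -/

variable {γ C : ℝ} {φ : ℕ → T3 → ℝ} {N : ℕ}

/-- The block weights are continuous in `x` (continuous kernel). -/
theorem continuous_wgtC (hφc : Continuous (φ N)) (w : Cfg N) (i : Fin (N + 1)) :
    Continuous fun x => wgtC N φ w x i :=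
  hφc.comp (continuous_const.sub continuous_id)

/-- The block velocity is measurable in `x` (inverse of a continuous function times a continuous
function; it is NOT continuous where the block empties). -/
theorem measurable_ubarC (hφc : Continuous (φ N)) (w : Cfg N) : Measurable fun x => ubarC N φ w x := by
  have h : (fun x => ubarC N φ w x) =
      fun x => (∑ i, wgtC N φ w x i)⁻¹ • ∑ i, wgtC N φ w x i • (w i).2 :=
    funext fun x => Pointwise.ubarC_eq N φ w x
  rw [h]
  exact (continuous_finsetSum _ fun i _ => continuous_wgtC hφc w i).measurable.inv.smul
    (continuous_finsetSum _ fun i _ => (continuous_wgtC hφc w i).smul continuous_const).measurable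

/-- The block moments are measurable in `x`. -/
theorem measurable_blkC {r : ℕ} (hφc : Continuous (φ N)) (w : Cfg N) (C' : Tens r) :
    Measurable fun x => blkC r N φ w x C' := by
  unfold blkC
  refine (Finset.measurable_sum _ fun i _ => ?_).const_mul _
  exact (continuous_wgtC hφc w i).measurable.mul (Reduction.measurable_pairT C'
    (Reduction.measurable_tpow (measurable_const.sub (measurable_ubarC hφc w))))

/-- Sup bound of the block moments of a configuration (admissible kernel):
`|blkC r C'| ≤ C (N+1)^{3γ} · cT r ‖C'‖ (2 v_max)^r`. -/
theorem abs_blkC_le {r : ℕ} (hadm : AdmissibleKernel γ C φ) (w : Cfg N) (x : T3) (C' : Tens r) :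
    |blkC r N φ w x C'| ≤
      C * ((N : ℝ) + 1) ^ (3 * γ) * (Reduction.cT r * ‖C'‖ * (2 * vmax N w) ^ r) := by
  obtain ⟨-, h0, -, -, hC, -⟩ := hadm
  have hV : ∀ i, ‖(w i).2‖ ≤ vmax N w := fun i =>
    Finset.le_sup' (fun i => ‖(w i).2‖) (Finset.mem_univ i)
  have hV0 : 0 ≤ vmax N w := (norm_nonneg _).trans (hV 0)
  have hu : ‖ubarC N φ w x‖ ≤ vmax N w := by
    rw [Pointwise.ubarC_eq]
    exact (Pointwise.avg_smul_eq_and_norm_le Finset.univ (fun i _ => h0 N _) (fun i _ => hV i) hV0).2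
  have hCw : 0 ≤ C * ((N : ℝ) + 1) ^ (3 * γ) := (h0 N 0).trans (hC N 0)
  have hcT : 0 ≤ Reduction.cT r := zero_le_one.trans (Reduction.one_le_cT r)
  unfold blkC
  refine Reduction.abs_avg_le _ fun i => ?_
  rw [abs_mul]
  refine mul_le_mul ?_ ((Reduction.abs_pairT_le C' _).trans ?_) (abs_nonneg _) hCw
  · show |φ N ((w i).1 - x)| ≤ _
    rw [abs_of_nonneg (h0 N _)]
    exact hC N _
  · refine mul_le_mul_of_nonneg_left ((Reduction.norm_tpow_le _).trans ?_) (by positivity)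
    exact pow_le_pow_left₀ (norm_nonneg _) ((norm_sub_le _ _).trans (by linarith [hV i, hu])) r

/-- Hence the block moments are in every `Lᵖₓ` (bounded and measurable on the finite-measure torus). -/
theorem memLp_blkC {r : ℕ} (hadm : AdmissibleKernel γ C φ) (w : Cfg N) (C' : Tens r) (p : ℝ≥0∞) :
    MemLp (fun x => blkC r N φ w x C') p volume :=
  MemLp.of_bound (measurable_blkC (hadm.1 N).continuous w C').aestronglyMeasurable _
    (ae_of_all _ fun x => by
      rw [Real.norm_eq_abs]
      exact abs_blkC_le hadm w x C')

/-- The square of the difference of two `L²` functions is integrable. -/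
theorem integrable_sq_sub {f g : T3 → ℝ} (hf : MemLp f 2 volume) (hg : MemLp g 2 volume) :
    Integrable fun x => (g x - f x) ^ 2 :=
  (memLp_two_iff_integrable_sq (hg.sub hf).1).1 (hg.sub hf)

/-- The integrand of `l2dist²` is integrable. -/
theorem integrable_l2Integrand (hadm : AdmissibleKernel γ C φ) (w w' : Cfg N) :
    Integrable fun x => (∑ j : Fin 3, ∑ k : Fin 3, (blkC 2 N φ w' x (C2 j k) - blkC 2 N φ w x (C2 j k)) ^ 2) +
      ∑ a : Fin 3, (blkC 3 N φ w' x (C3 a) - blkC 3 N φ w x (C3 a)) ^ 2 :=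
  (integrable_finsetSum _ fun j _ => integrable_finsetSum _ fun k _ =>
    integrable_sq_sub (memLp_blkC hadm w (C2 j k) 2) (memLp_blkC hadm w' (C2 j k) 2)).add
    (integrable_finsetSum _ fun a _ =>
      integrable_sq_sub (memLp_blkC hadm w (C3 a) 2) (memLp_blkC hadm w' (C3 a) 2))

/-- The defect `Σ D² + |q|²` of a configuration is integrable in `x`. -/
theorem integrable_defectC (hadm : AdmissibleKernel γ C φ) (w : Cfg N) :
    Integrable fun x => defectC N φ w x := by
  have h := fun (r : ℕ) (C' : Tens r) =>
    (memLp_two_iff_integrable_sq (memLp_blkC hadm w C' 2).1).1 (memLp_blkC hadm w C' 2)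
  unfold defectC
  exact (integrable_finsetSum _ fun j _ => integrable_finsetSum _ fun k _ => h 2 (C2 j k)).add
    (integrable_finsetSum _ fun a _ => h 3 (C3 a))

/-- The defect is nonnegative. -/
theorem defectC_nonneg (φ : ℕ → T3 → ℝ) (w : Cfg N) (x : T3) : 0 ≤ defectC N φ w x :=
  add_nonneg (Finset.sum_nonneg fun _ _ => Finset.sum_nonneg fun _ _ => sq_nonneg _)
    (Finset.sum_nonneg fun _ _ => sq_nonneg _)

/-- The anisotropy is nonnegative. -/
theorem anisC_nonneg (φ : ℕ → T3 → ℝ) (w : Cfg N) : 0 ≤ anisC N φ w :=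
  integral_nonneg fun x => defectC_nonneg φ w x

/-- The square root of a nonnegative integrable function is in `L²`. -/
theorem memLp_two_sqrt {f : T3 → ℝ} (hf : Integrable f) (h0 : ∀ x, 0 ≤ f x) :
    MemLp (fun x => Real.sqrt (f x)) 2 volume := by
  have hm : AEStronglyMeasurable (fun x => Real.sqrt (f x)) volume :=
    (Real.continuous_sqrt.measurable.comp_aemeasurable hf.aemeasurable).aestronglyMeasurable
  exact (memLp_two_iff_integrable_sq hm).2 (hf.congr (ae_of_all _ fun x => (Real.sq_sqrt (h0 x)).symm))

/-! ## The reverse triangle inequality in `L²ₓ` -/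

/-- REVERSE TRIANGLE: `|anis(w₂) − anis(w₁)| ≤ 12 · l2dist(w₁, w₂) · (√anis(w₁) + √anis(w₂))`. -/
theorem abs_anisC_sub_le (hadm : AdmissibleKernel γ C φ) (w₁ w₂ : Cfg N) :
    |anisC N φ w₂ - anisC N φ w₁| ≤
      12 * l2dist N φ w₁ w₂ * (Real.sqrt (anisC N φ w₁) + Real.sqrt (anisC N φ w₂)) := by
  set E : T3 → ℝ := fun x => (∑ j : Fin 3, ∑ k : Fin 3,
    (blkC 2 N φ w₂ x (C2 j k) - blkC 2 N φ w₁ x (C2 j k)) ^ 2) +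
      ∑ a : Fin 3, (blkC 3 N φ w₂ x (C3 a) - blkC 3 N φ w₁ x (C3 a)) ^ 2 with hE
  have hE0 : ∀ x, 0 ≤ E x := fun x =>
    add_nonneg (Finset.sum_nonneg fun _ _ => Finset.sum_nonneg fun _ _ => sq_nonneg _)
      (Finset.sum_nonneg fun _ _ => sq_nonneg _)
  have hEi : Integrable E := integrable_l2Integrand hadm w₁ w₂
  have hA := integrable_defectC hadm w₁
  have hB := integrable_defectC hadm w₂
  have hA0 := defectC_nonneg (N := N) φ w₁
  have hB0 := defectC_nonneg (N := N) φ w₂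
  have mE := memLp_two_sqrt hEi hE0
  have mA := memLp_two_sqrt hA hA0
  have mB := memLp_two_sqrt hB hB0
  -- pointwise
  have hpt : ∀ x, |defectC N φ w₂ x - defectC N φ w₁ x| ≤
      12 * (Real.sqrt (E x) * (Real.sqrt (defectC N φ w₁ x) + Real.sqrt (defectC N φ w₂ x))) :=
    fun x => abs_defect_sub_defect_le (fun j k => blkC 2 N φ w₁ x (C2 j k))
      (fun j k => blkC 2 N φ w₂ x (C2 j k)) (fun a => blkC 3 N φ w₁ x (C3 a)) (fun a => blkC 3 N φ w₂ x (C3 a))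
  -- integrate
  have hprodA : Integrable fun x => Real.sqrt (E x) * Real.sqrt (defectC N φ w₁ x) := mE.integrable_mul mA
  have hprodB : Integrable fun x => Real.sqrt (E x) * Real.sqrt (defectC N φ w₂ x) := mE.integrable_mul mB
  have hCSA := integral_mul_le_sqrt_mul_sqrt (fun x => Real.sqrt_nonneg (E x))
    (fun x => Real.sqrt_nonneg (defectC N φ w₁ x)) mE mA
  have hCSB := integral_mul_le_sqrt_mul_sqrt (fun x => Real.sqrt_nonneg (E x))
    (fun x => Real.sqrt_nonneg (defectC N φ w₂ x)) mE mB
  simp only [Real.sq_sqrt (hE0 _), Real.sq_sqrt (hA0 _), Real.sq_sqrt (hB0 _)] at hCSA hCSB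
  have hl2 : l2dist N φ w₁ w₂ = Real.sqrt (∫ x, E x) := rfl
  have ha1 : anisC N φ w₁ = ∫ x, defectC N φ w₁ x := rfl
  have ha2 : anisC N φ w₂ = ∫ x, defectC N φ w₂ x := rfl
  rw [hl2, ha1, ha2, ← integral_sub hB hA]
  calc |∫ x, (defectC N φ w₂ x - defectC N φ w₁ x)|
      ≤ ∫ x, |defectC N φ w₂ x - defectC N φ w₁ x| := abs_integral_le_integral_abs
    _ ≤ ∫ x, 12 * (Real.sqrt (E x) * (Real.sqrt (defectC N φ w₁ x) + Real.sqrt (defectC N φ w₂ x))) :=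
        integral_mono (hB.sub hA).abs (((hprodA.add hprodB).congr (ae_of_all _ fun x => by
          simp only [Pi.add_apply, mul_add])).const_mul 12) hpt
    _ = 12 * ((∫ x, Real.sqrt (E x) * Real.sqrt (defectC N φ w₁ x)) +
          ∫ x, Real.sqrt (E x) * Real.sqrt (defectC N φ w₂ x)) := by
        rw [integral_const_mul, ← integral_add hprodA hprodB]
        simp only [mul_add]
    _ ≤ 12 * (Real.sqrt (∫ x, E x) * Real.sqrt (∫ x, defectC N φ w₁ x) +
          Real.sqrt (∫ x, E x) * Real.sqrt (∫ x, defectC N φ w₂ x)) := by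
        gcongr
    _ = _ := by ring

end FreeStretch

open FreeStretch in
/-- STUB 3 (Lipschitz ⇒ free-stretch bound: `|anis(w') − anis(w)| ≤ 12 · l2dist · (√anis w + √anis w')`
(Cauchy–Schwarz in `L²ₓ`; the twelve components of `(D,q)` are bounded measurable in `x`), so `√anis` is
`12 K (N+1)^γ (1+v_max)⁴`-Lipschitz along the flight (`v_max` is a free-flight invariant, `freeFlight` is
additive in time), `anis = (√anis)²` is absolutely continuous and
`anis(T) − anis(0) = ∫₀ᵀ anis' ≤ 24 K (N+1)^γ (1+v_max)⁴ ∫₀ᵀ √anis`). -/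
theorem stub_freeStretch : ∀ (γ C : ℝ) (φ : ℕ → T3 → ℝ), 0 < γ → γ ≤ 1 / 15 → AdmissibleKernel γ C φ →
    ∀ σ : ℝ, 0 < σ → σ < 2⁻¹ → FreeFlightLipschitz γ φ σ → FreeStretchBound γ φ σ := by
  intro γ C φ _hγ _hγ' hadm σ _hσ _hσ' hlip
  obtain ⟨K, N₀, hK⟩ := hlip
  refine ⟨24 * max K 0, N₀, fun N hN w T hT hdom => ?_⟩
  have hV0 : 0 ≤ vmax N w :=
    (norm_nonneg _).trans (Finset.le_sup' (fun i => ‖(w i).2‖) (Finset.mem_univ 0))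
  set ℓ : ℝ := max K 0 * ((N + 1 : ℕ) : ℝ) ^ γ * (1 + vmax N w) ^ 4 with hℓdef
  have hℓ0 : 0 ≤ ℓ := by positivity
  -- (a) the `L²ₓ`-Lipschitz hypothesis along the stretch (free flight is additive, keeps `v_max`)
  have hdist : ∀ r r', r ∈ Icc 0 T → r' ∈ Icc 0 T → r ≤ r' →
      l2dist N φ (freeFlight (Torus.geometry (Fin 3)) r w) (freeFlight (Torus.geometry (Fin 3)) r' w) ≤
        ℓ * (r' - r) := by
    intro r r' hr hr' hrr'
    have e : freeFlight (Torus.geometry (Fin 3)) (r' - r) (freeFlight (Torus.geometry (Fin 3)) r w) =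
        freeFlight (Torus.geometry (Fin 3)) r' w := by
      rw [← freeFlight_add, sub_add_cancel]
    have h1 := hK N hN (freeFlight (Torus.geometry (Fin 3)) r w) (r' - r) (sub_nonneg.2 hrr') (hdom r hr)
      (by rw [e]; exact hdom r' hr')
    rw [e] at h1
    refine h1.trans ?_
    have hvm : vmax N (freeFlight (Torus.geometry (Fin 3)) r w) = vmax N w := rfl
    rw [hvm, hℓdef]
    have h2 : 0 ≤ ((N + 1 : ℕ) : ℝ) ^ γ * (1 + vmax N w) ^ 4 * (r' - r) :=
      mul_nonneg (by positivity) (sub_nonneg.2 hrr')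
    calc K * ((N + 1 : ℕ) : ℝ) ^ γ * (1 + vmax N w) ^ 4 * (r' - r)
        = K * (((N + 1 : ℕ) : ℝ) ^ γ * (1 + vmax N w) ^ 4 * (r' - r)) := by ring
      _ ≤ max K 0 * (((N + 1 : ℕ) : ℝ) ^ γ * (1 + vmax N w) ^ 4 * (r' - r)) :=
          mul_le_mul_of_nonneg_right (le_max_left K 0) h2
      _ = max K 0 * ((N + 1 : ℕ) : ℝ) ^ γ * (1 + vmax N w) ^ 4 * (r' - r) := by ring
  -- (b)+(c) `√anis` is `12ℓ`-Lipschitz along the stretch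
  have key : ∀ r r', r ∈ Icc 0 T → r' ∈ Icc 0 T → r ≤ r' →
      dist (Real.sqrt (anisC N φ (freeFlight (Torus.geometry (Fin 3)) r w)))
          (Real.sqrt (anisC N φ (freeFlight (Torus.geometry (Fin 3)) r' w))) ≤ 12 * ℓ * dist r r' := by
    intro r r' hr hr' hrr'
    rw [dist_comm, Real.dist_eq, Real.dist_eq, abs_sub_comm r r', abs_of_nonneg (sub_nonneg.2 hrr')]
    have hd0 : 0 ≤ 12 * ℓ * (r' - r) := mul_nonneg (by positivity) (sub_nonneg.2 hrr')
    refine abs_sub_le_of_abs_sq_sub_sq_le (Real.sqrt_nonneg _) (Real.sqrt_nonneg _) hd0 ?_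
    rw [Real.sq_sqrt (anisC_nonneg _ _), Real.sq_sqrt (anisC_nonneg _ _)]
    refine (abs_anisC_sub_le hadm _ _).trans (mul_le_mul_of_nonneg_right ?_
      (add_nonneg (Real.sqrt_nonneg _) (Real.sqrt_nonneg _)))
    have h := hdist r r' hr hr' hrr'
    nlinarith [h]
  have hglip : LipschitzOnWith (12 * ℓ).toNNReal
      (fun r => Real.sqrt (anisC N φ (freeFlight (Torus.geometry (Fin 3)) r w))) (Icc 0 T) :=
    LipschitzOnWith.of_dist_le' fun r hr r' hr' => by
      rcases le_total r r' with hrr' | hrr'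
      · exact key r r' hr hr' hrr'
      · calc _ = _ := dist_comm _ _
          _ ≤ 12 * ℓ * dist r' r := key r' r hr' hr hrr'
          _ = 12 * ℓ * dist r r' := by rw [dist_comm]
  -- (d) calculus
  have h12 : 0 ≤ 12 * ℓ := by positivity
  have hfin := sq_sub_sq_le_integral hT h12 (fun r _ => Real.sqrt_nonneg _) hglip
  rw [Real.sq_sqrt (anisC_nonneg _ _), Real.sq_sqrt (anisC_nonneg _ _), freeFlight_zero] at hfin
  calc _ ≤ _ := hfin
    _ = _ := by rw [hℓdef]; ring

end

end Summit.AtomisticToContinuum.HydrodynamicLimit.Theorems.ContactBalance
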